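import Mathlib
import Summits.Ventures.PercRepro2.MixChordOStarMirror
import Summits.Ventures.PercRepro2.MixChordOStarBKey

/-!
# THE `o`–ROOT STAR ALONG THE OTHER `o`-EDGE (blind cell PercRepro2, night-1 g24; proofs/NIGHT1-G24.md §8a)

`a₃` has exactly the two edges `g = {a₃, o}` (weight `r`) and `e = {a₃, a₁}` (weight `t`); the chord is taken
along `f' = {o, a₂}` — the `o`-edge to the root NOT joined to `a₃` — the other `o`-edge `f = {o, a₁}` being
present with any weight.  The dictionary `Gc_star` / `D_star` (MixChordOStarMasses.lean) is the same; what
changes is the pin: at `f'` open `o ∈ C₂` surely (the coincidence lemmas with the roots swapped), g18's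
couplings across `f'` hold with the roots swapped, and the merged world `a₃ ≡ a₁ ≡ o` (masses at `p₀₀[f ↦ 1]`)
loses every `Q`-mass once `f'` opens (`a₁ ↔ o ↔ a₂`); its masses at `f'` closed are g18's couplings across `f`
at `p₀₀[f' ↦ 0]`, read through the pin of `f` (`coupling_Q_at`, `coupling_bH_at`, `coupling_bL_at_ge`).
The algebraic key `star_key₂` (MixChordOStarBKey.lean) closes the chord.

* **`dChord_other_o_edge_of_o_root_star`** — the `o`-class `D`-chord along `{o, a₂}`;
* **`dz2Chord_other_o_edge_of_o_root_star`** — the chain's `DZ2` row (`NMixChord normDZ2`), from the `D`-chord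
  and (HCOV) on the star (`HCov_o_root_star`);
* the mirrors **`dChord_other_o_edge₂_of_o_root_star`** / **`dz2Chord_other_o_edge₂_of_o_root_star`** (edges
  `{a₃, o}`, `{a₃, a₂}`, chord along `{o, a₁}`).

Own code; standard axioms.
-/

namespace Summit.Ventures.PercRepro2

open UnionCluster CovForm

namespace Mix

namespace OStar

section BMain

variable {V : Type*} {E : Type*} [Fintype E] [DecidableEq E] [Fintype V] [DecidableEq V] {R : Type*}
  [Field R] [LinearOrder R] [IsStrictOrderedRing R]

variable (p : E → R) (ends : E → Sym2 V) {o a₁ a₂ a₃ : V} (b : V) {g e f f' : E}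

omit [Fintype E] [DecidableEq E] [Fintype V] [DecidableEq V] [Field R] [LinearOrder R] [IsStrictOrderedRing R] in
/-- `e = {a₃, a₁}` is not `f' = {o, a₂}`. -/
lemma star_ne_ef' (he : ends e = s(a₃, a₁)) (hf' : ends f' = s(o, a₂)) (h23 : a₂ ≠ a₃) (ho3 : o ≠ a₃) :
    e ≠ f' := by
  intro h
  rw [h, hf'] at he
  rcases Sym2.eq_iff.1 he with ⟨h1, _⟩ | ⟨_, h2⟩
  · exact ho3 h1
  · exact h23 h2

omit [Fintype E] [DecidableEq E] [Fintype V] [DecidableEq V] [Field R] [LinearOrder R] [IsStrictOrderedRing R] in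
/-- The two `o`-edges differ. -/
lemma star_ne_ff' (hf : ends f = s(o, a₁)) (hf' : ends f' = s(o, a₂)) (h12 : a₁ ≠ a₂) (ho2 : o ≠ a₂) :
    f ≠ f' := by
  intro h
  rw [h, hf'] at hf
  rcases Sym2.eq_iff.1 hf with ⟨_, h2⟩ | ⟨_, h2⟩
  · exact h12 h2.symm
  · exact ho2 h2.symm

omit [Fintype V] [DecidableEq V] [LinearOrder R] [IsStrictOrderedRing R] in
/-- Every `Q`-mass vanishes when `a₁ ↔ a₂` surely. -/
lemma prob_Q_inter_eq_zero_of_conn_roots (h : ∀ ω, weight p ω ≠ 0 → Conn ends ω a₁ a₂)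
    (B : Set (Config E)) : prob p (avoidAll ends a₂ {a₁} ∩ B) = 0 := by
  unfold prob
  refine Finset.sum_eq_zero fun ω _ => ?_
  by_cases hω : weight p ω = 0
  · simp [hω]
  · rw [Set.indicator_of_notMem]
    rintro ⟨hQ, _⟩
    exact hQ a₁ (Finset.mem_singleton_self a₁) (conn_symm (h ω hω))

omit [Fintype V] [DecidableEq V] in
/-- With both `o`-edges open, `a₁ ↔ a₂` surely. -/
lemma conn_roots_of_update_one_one (hf : ends f = s(o, a₁)) (hf' : ends f' = s(o, a₂)) (hff' : f ≠ f') :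
    ∀ ω, weight (Function.update (Function.update p f 1) f' 1) ω ≠ 0 → Conn ends ω a₁ a₂ := by
  intro ω hω
  have h2 : ω f' = true := eq_true_of_weight_update_one_ne_zero hω
  rw [Function.update_comm hff'] at hω
  have h1 : ω f = true := eq_true_of_weight_update_one_ne_zero hω
  exact conn_trans (conn_symm (conn_of_openAdj ⟨f, h1, hf⟩)) (conn_of_openAdj ⟨f', h2, hf'⟩)

omit [Fintype V] [DecidableEq V] in
/-- g18's coupling of `Q` across `f = {o, a₁}`, read at the instance itself through the pin of `f`:
`P¹(Q) = P(Q) − P(Q, a₂ ↔ o)`. -/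
lemma coupling_Q_at (hf : ends f = s(o, a₁)) :
    prob (Function.update p f 1) (avoidAll ends a₂ {a₁}) =
      prob p (avoidAll ends a₂ {a₁}) - prob p (avoidAll ends a₂ {a₁} ∩ connEvent ends a₂ o) := by
  have h1 := RootEdge.prob_Q_update_one p ends (a₂ := a₂) hf
  rw [TEvent_o] at h1
  have h2 := prob_eq_pin p (avoidAll ends a₂ {a₁}) f
  have h3 := prob_eq_pin p (avoidAll ends a₂ {a₁} ∩ connEvent ends a₂ o) f
  have hc1 := conn_a1_o_of_update_one p ends hf
  have h4 := prob_Q_conn₂_eq_zero (Function.update p f 1) ends (a₂ := a₂) hc1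
  rw [h2, h3, h4, h1]
  ring

omit [Fintype V] [DecidableEq V] in
/-- g18's coupling of `Q ∩ {a₂ ↔ b}` across `f = {o, a₁}`, read at the instance itself through the pin:
`P¹(Q, a₂ ↔ b) = P(Q, a₂ ↔ b) − P(Q, a₂ ↔ o, a₂ ↔ b)`. -/
lemma coupling_bH_at (hf : ends f = s(o, a₁)) :
    prob (Function.update p f 1) (avoidAll ends a₂ {a₁} ∩ connEvent ends a₂ b) =
      prob p (avoidAll ends a₂ {a₁} ∩ connEvent ends a₂ b) -
        prob p (avoidAll ends a₂ {a₁} ∩ (connEvent ends a₂ o ∩ connEvent ends a₂ b)) := by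
  have h1 := RootEdge.prob_Q_conn2_update_one p ends (a₂ := a₂) hf b
  rw [TEvent_o_inter] at h1
  have h2 := prob_eq_pin p (avoidAll ends a₂ {a₁} ∩ connEvent ends a₂ b) f
  have h3 := prob_eq_pin p (avoidAll ends a₂ {a₁} ∩ (connEvent ends a₂ o ∩ connEvent ends a₂ b)) f
  have hc1 := conn_a1_o_of_update_one p ends hf
  have h4 := prob_inter_conn₂_eq_zero (Function.update p f 1) ends (a₂ := a₂) hc1
    (avoidAll ends a₂ {a₁}) (connEvent ends a₂ b) le_rfl
  rw [h2, h3, h4, h1]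
  ring

omit [Fintype V] [DecidableEq V] in
/-- g18's coupling of `Q ∩ {a₁ ↔ b}` across `f = {o, a₁}`, read at the instance itself through the pin:
`P(Q, a₁ ↔ b) − P(Q, a₂ ↔ o, a₁ ↔ b) ≤ P¹(Q, a₁ ↔ b)`. -/
lemma coupling_bL_at_ge (hp : IsProbVec p) (hf : ends f = s(o, a₁)) :
    prob p (avoidAll ends a₂ {a₁} ∩ connEvent ends a₁ b) -
        prob p (avoidAll ends a₂ {a₁} ∩ (connEvent ends a₂ o ∩ connEvent ends a₁ b)) ≤
      prob (Function.update p f 1) (avoidAll ends a₂ {a₁} ∩ connEvent ends a₁ b) := by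
  have h1 := RootEdge.prob_Q_conn1_update_one_ge p ends (a₂ := a₂) hp hf b
  rw [TEvent_o_inter] at h1
  have h2 := prob_eq_pin p (avoidAll ends a₂ {a₁} ∩ connEvent ends a₁ b) f
  have h3 := prob_eq_pin p (avoidAll ends a₂ {a₁} ∩ (connEvent ends a₂ o ∩ connEvent ends a₁ b)) f
  have hc1 := conn_a1_o_of_update_one p ends hf
  have h4 := prob_inter_conn₂_eq_zero (Function.update p f 1) ends (a₂ := a₂) hc1
    (avoidAll ends a₂ {a₁}) (connEvent ends a₁ b) le_rfl
  have h5 := mul_le_mul_of_nonneg_left h1 (sub_nonneg.2 (hp.le_one f))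
  rw [h2, h3, h4]
  linarith

/-- **THE `o`–ROOT STAR ALONG THE OTHER `o`-EDGE: the `o`-class `D`-chord along `f' = {o, a₂}`**
(`NMixChord normD`), for `a₃` with exactly the two edges `g = {a₃, o}` and `e = {a₃, a₁}` (any weights), the
`o`-edge `f = {o, a₁}` present with any weight. -/
theorem dChord_other_o_edge_of_o_root_star (hp : IsProbVec p) (hf : ends f = s(o, a₁))
    (hf' : ends f' = s(o, a₂)) (hg : ends g = s(a₃, o)) (he : ends e = s(a₃, a₁))
    (hstar : ∀ e', a₃ ∈ ends e' → e' = g ∨ e' = e) (h12 : a₁ ≠ a₂) (h13 : a₁ ≠ a₃) (h23 : a₂ ≠ a₃)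
    (ho1 : o ≠ a₁) (ho2 : o ≠ a₂) (ho3 : o ≠ a₃) (hb3 : b ≠ a₃) :
    NMixChord (normD ends a₁ a₂ a₃) p ends o a₁ a₂ a₃ b f' := by
  have hge : g ≠ e := star_ne_ge ends hg he h13 ho1
  have hgf : g ≠ f := star_ne_gf ends hg hf h13 ho3
  have hef : e ≠ f := star_ne_ef ends he hf h13 ho3
  have hgf' : g ≠ f' := star_ne_gf ends hg hf' h23 ho3
  have hef' : e ≠ f' := star_ne_ef' ends he hf' h23 ho3
  have hff' : f ≠ f' := star_ne_ff' ends hf hf' h12 ho2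
  -- `Gc` vanishes with `f'` open (`o ∈ C₂` surely)
  have hG1 : Gc (Function.update p f' 1) ends o a₁ a₂ a₃ b = 0 := by
    rw [← Gc_swap]
    exact Gc_eq_zero_of_sure_conn_o _ ends o a₃ b (a₁ := a₂) (a₂ := a₁) (conn_a1_o_of_update_one p ends hf')
  unfold NMixChord normD
  rw [hG1, mul_zero, sub_zero]
  -- the dictionary at `p` and at `p[f' ↦ 0]`
  rw [Gc_star p hg he hstar hf hge hgf hef h13 h23 ho3 hb3, D_star p hg he hstar hf hge hgf hef h13 h23 ho3 hb3,
    Gc_star (Function.update p f' 0) hg he hstar hf hge hgf hef h13 h23 ho3 hb3,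
    D_star (Function.update p f' 0) hg he hstar hf hge hgf hef h13 h23 ho3 hb3,
    upd_f0 p hgf' hef', Function.update_of_ne hgf', Function.update_of_ne hef']
  -- the base instance, its `f'`-pins and the merged world
  set p₀₀ := Function.update (Function.update p g 0) e 0 with hp₀₀
  have hp00 : IsProbVec p₀₀ := (hp.update g le_rfl zero_le_one).update e le_rfl zero_le_one
  have hp0 : IsProbVec (Function.update p₀₀ f' 0) := hp00.update f' le_rfl zero_le_one
  have hp1f : IsProbVec (Function.update p₀₀ f 1) := hp00.update f zero_le_one le_rfl
  have hqf : p₀₀ f' = p f' := by rw [hp₀₀, Function.update_of_ne hef'.symm, Function.update_of_ne hgf'.symm]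
  have hqf1 : (Function.update p₀₀ f 1) f' = p f' := by rw [Function.update_of_ne hff'.symm, hqf]
  have hcomm : Function.update (Function.update p₀₀ f 1) f' 0 = Function.update (Function.update p₀₀ f' 0) f 1 :=
    Function.update_comm hff' 1 0 p₀₀
  -- at `p₀₀[f' ↦ 1]`, `o ∈ C₂` surely
  have hc2 := conn_a1_o_of_update_one p₀₀ ends hf'
  have hLo1 := prob_Q_conn₂_eq_zero (Function.update p₀₀ f' 1) ends (a₁ := a₂) (a₂ := a₁) hc2
  rw [avoidAll_root_swap] at hLo1
  have hHo1 := prob_inter_conn_eq' (Function.update p₀₀ f' 1) ends (a₁ := a₂) hc2 (avoidAll ends a₂ {a₁})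
  have hLL1 := prob_inter_conn₂_eq_zero (Function.update p₀₀ f' 1) ends (a₁ := a₂) (a₂ := a₁) hc2
    (avoidAll ends a₂ {a₁}) (connEvent ends a₁ b) (by rw [avoidAll_root_swap])
  have hLH1 := prob_inter_conn₂_eq_zero (Function.update p₀₀ f' 1) ends (a₁ := a₂) (a₂ := a₁) hc2
    (avoidAll ends a₂ {a₁}) (connEvent ends a₂ b) (by rw [avoidAll_root_swap])
  have hHL1 := prob_inter_conn_eq (Function.update p₀₀ f' 1) ends (a₁ := a₂) hc2 (avoidAll ends a₂ {a₁})
    (connEvent ends a₁ b)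
  have hHH1 := prob_inter_conn_eq (Function.update p₀₀ f' 1) ends (a₁ := a₂) hc2 (avoidAll ends a₂ {a₁})
    (connEvent ends a₂ b)
  -- g18's couplings across `f'` (roots swapped)
  have hZ1' := RootEdge.prob_Q_update_one p₀₀ ends (a₁ := a₂) (a₂ := a₁) hf'
  rw [avoidAll_root_swap, TEvent'_eq] at hZ1'
  have hLb1' := RootEdge.prob_Q_conn2_update_one p₀₀ ends (a₁ := a₂) (a₂ := a₁) hf' b
  rw [avoidAll_root_swap, TEvent'_inter] at hLb1'
  have hHb1' := RootEdge.prob_Q_conn1_update_one_ge p₀₀ ends (a₁ := a₂) (a₂ := a₁) hp00 hf' b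
  rw [avoidAll_root_swap, TEvent'_inter] at hHb1'
  -- the merged world at `f'` closed: g18's couplings across `f` at `p₀₀[f' ↦ 0]`
  have hZ10 := coupling_Q_at (Function.update p₀₀ f' 0) ends (a₂ := a₂) hf
  have hB10 := coupling_bH_at (Function.update p₀₀ f' 0) ends b (a₂ := a₂) hf
  have hL10 := coupling_bL_at_ge (Function.update p₀₀ f' 0) ends b (a₂ := a₂) hp0 hf
  -- the merged world at `f'` open: every `Q`-mass vanishes
  have hcr := conn_roots_of_update_one_one p₀₀ ends hf hf' hff'
  have hv := prob_Q_inter_eq_zero_of_conn_roots (Function.update (Function.update p₀₀ f 1) f' 1) ends hcr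
  have hvZ : prob (Function.update (Function.update p₀₀ f 1) f' 1) (avoidAll ends a₂ {a₁}) = 0 := by
    have := hv Set.univ
    rwa [Set.inter_univ] at this
  -- the pins of `f'`
  have pZ := prob_eq_pin p₀₀ (avoidAll ends a₂ {a₁}) f'
  have pLo := prob_eq_pin p₀₀ (avoidAll ends a₂ {a₁} ∩ connEvent ends a₁ o) f'
  have pHo := prob_eq_pin p₀₀ (avoidAll ends a₂ {a₁} ∩ connEvent ends a₂ o) f'
  have pLb := prob_eq_pin p₀₀ (avoidAll ends a₂ {a₁} ∩ connEvent ends a₁ b) f'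
  have pHb := prob_eq_pin p₀₀ (avoidAll ends a₂ {a₁} ∩ connEvent ends a₂ b) f'
  have pLH := prob_eq_pin p₀₀ (avoidAll ends a₂ {a₁} ∩ (connEvent ends a₁ o ∩ connEvent ends a₂ b)) f'
  have pHL := prob_eq_pin p₀₀ (avoidAll ends a₂ {a₁} ∩ (connEvent ends a₂ o ∩ connEvent ends a₁ b)) f'
  have pHH := prob_eq_pin p₀₀ (avoidAll ends a₂ {a₁} ∩ (connEvent ends a₂ o ∩ connEvent ends a₂ b)) f'
  rw [hqf] at pZ pLo pHo pLb pHb pLH pHL pHH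
  have pZ1 := prob_eq_pin (Function.update p₀₀ f 1) (avoidAll ends a₂ {a₁}) f'
  have pL1 := prob_eq_pin (Function.update p₀₀ f 1) (avoidAll ends a₂ {a₁} ∩ connEvent ends a₁ b) f'
  have pB1 := prob_eq_pin (Function.update p₀₀ f 1) (avoidAll ends a₂ {a₁} ∩ connEvent ends a₂ b) f'
  rw [hqf1, hcomm, hvZ] at pZ1
  rw [hqf1, hcomm, hv] at pL1 pB1
  -- the nonnegative masses at `p₀₀[f' ↦ 0]`
  have hZ0n := prob_nonneg hp0 (avoidAll ends a₂ {a₁})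
  have hLo0n := prob_nonneg hp0 (avoidAll ends a₂ {a₁} ∩ connEvent ends a₁ o)
  have hHo0n := prob_nonneg hp0 (avoidAll ends a₂ {a₁} ∩ connEvent ends a₂ o)
  have hZmLo : 0 ≤ prob (Function.update p₀₀ f' 0) (avoidAll ends a₂ {a₁}) -
      prob (Function.update p₀₀ f' 0) (avoidAll ends a₂ {a₁} ∩ connEvent ends a₁ o) :=
    sub_nonneg.2 (prob_inter_le_left hp0 _ _)
  have hZmHo : 0 ≤ prob (Function.update p₀₀ f' 0) (avoidAll ends a₂ {a₁}) -
      prob (Function.update p₀₀ f' 0) (avoidAll ends a₂ {a₁} ∩ connEvent ends a₂ o) :=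
    sub_nonneg.2 (prob_inter_le_left hp0 _ _)
  have hN0 : 0 ≤ prob (Function.update p₀₀ f' 0) (avoidAll ends a₂ {a₁}) -
      prob (Function.update p₀₀ f' 0) (avoidAll ends a₂ {a₁} ∩ connEvent ends a₁ o) -
      prob (Function.update p₀₀ f' 0) (avoidAll ends a₂ {a₁} ∩ connEvent ends a₂ o) := by
    have h := prob_PD_v_univ (Function.update p₀₀ f' 0) ends a₁ a₂ o
    have h0 := prob_nonneg hp0 (PDEvent ends a₁ a₂ o)
    linarith
  -- the seven BHK facts at `p₀₀[f' ↦ 0]`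
  have hs2n := PendantRoot.covC_same_nonneg (Function.update p₀₀ f' 0) ends hp0 o a₂ a₁ b
  rw [covC_root_swap] at hs2n
  unfold PendantRoot.covC at hs2n
  have hs34 := PendantRoot.covC_cross_nonpos (Function.update p₀₀ f' 0) ends hp0 o a₁ a₂ b
  unfold PendantRoot.covC at hs34
  obtain ⟨hs4n, hs3n⟩ := hs34
  have hs5n := bhk_oH_bL_avoid (Function.update p₀₀ f' 0) ends b hp0 o a₁ a₂
  have hs10n := bhk_oH_bH_avoid (Function.update p₀₀ f' 0) ends b hp0 o a₁ a₂
  have hs6n := bhk_oH_bL_avoid (Function.update p₀₀ f' 0) ends b hp0 o a₂ a₁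
  rw [avoidAll_root_swap] at hs6n
  have hs11n := bhk_oH_bH_avoid (Function.update p₀₀ f' 0) ends b hp0 o a₂ a₁
  rw [avoidAll_root_swap] at hs11n
  -- the algebraic key
  have hq0 := hp.nonneg f'
  have hq1 := hp.le_one f'
  have hr0 := hp.nonneg g
  have hr1 := hp.le_one g
  have ht0 := hp.nonneg e
  have ht1 := hp.le_one e
  exact star_key₂ _ _ _ _ _ _ _ _ _ _ _ _ _ _ _ _ _ _ _ _ _ _ _ _
    (prob (Function.update p₀₀ f' 1) (avoidAll ends a₂ {a₁} ∩ connEvent ends a₂ b) -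
      (prob (Function.update p₀₀ f' 0) (avoidAll ends a₂ {a₁} ∩ connEvent ends a₂ b) -
        prob (Function.update p₀₀ f' 0) (avoidAll ends a₂ {a₁} ∩ (connEvent ends a₁ o ∩ connEvent ends a₂ b))))
    (prob (Function.update (Function.update p₀₀ f' 0) f 1) (avoidAll ends a₂ {a₁} ∩ connEvent ends a₁ b) -
      (prob (Function.update p₀₀ f' 0) (avoidAll ends a₂ {a₁} ∩ connEvent ends a₁ b) -
        prob (Function.update p₀₀ f' 0) (avoidAll ends a₂ {a₁} ∩ (connEvent ends a₂ o ∩ connEvent ends a₁ b))))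
    (p f') (p g) (p e) (1 - p f') (1 - p g) (1 - p e) _ _ _ _ _ _ _
    hr0 ht0 rfl rfl (sub_nonneg.2 hr1) (sub_nonneg.2 ht1)
    hZ10 (by ring) hB10
    hq0 rfl (sub_nonneg.2 hq1)
    hZ0n hLo0n hHo0n (sub_nonneg.2 hHb1') (sub_nonneg.2 hL10) hN0 hZmLo hZmHo
    (by rw [pZ1, hZ10]; ring) (by rw [pL1]; ring) (by rw [pB1, hB10]; ring)
    (by rw [pZ, hZ1']; ring) (by rw [pLo, hLo1]; ring) (by rw [pHo, hHo1, hZ1']; ring)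
    (by rw [pLb, hLb1']; ring) (by rw [pHb]; ring) (by rw [pLH, hLH1]; ring)
    (by rw [pHL, hHL1, hLb1']; ring) (by rw [pHH, hHH1]; ring)
    rfl rfl rfl rfl rfl rfl rfl
    hs2n (by linarith) (by linarith) (by linarith) (by linarith) (by linarith) (by linarith)

/-- **The chain's `DZ2` row along the other `o`-edge**: `NMixChord normDZ2` on the star, from the `D`-chord and
(HCOV) at `p[f' ↦ 0]` (`HCov_o_root_star`), through `nMixChord_DZ2_of_D`. -/
theorem dz2Chord_other_o_edge_of_o_root_star (hp : IsProbVec p) (hf : ends f = s(o, a₁))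
    (hf' : ends f' = s(o, a₂)) (hg : ends g = s(a₃, o)) (he : ends e = s(a₃, a₁))
    (hstar : ∀ e', a₃ ∈ ends e' → e' = g ∨ e' = e) (h12 : a₁ ≠ a₂) (h13 : a₁ ≠ a₃) (h23 : a₂ ≠ a₃)
    (ho1 : o ≠ a₁) (ho2 : o ≠ a₂) (ho3 : o ≠ a₃) (hb3 : b ≠ a₃) :
    NMixChord (normDZ2 ends a₁ a₂ a₃) p ends o a₁ a₂ a₃ b f' :=
  nMixChord_DZ2_of_D hp
    (dChord_other_o_edge_of_o_root_star p ends b hp hf hf' hg he hstar h12 h13 h23 ho1 ho2 ho3 hb3)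
    (HCov_o_root_star (Function.update p f' 0) ends b (hp.update f' le_rfl zero_le_one) hg he hstar h13 h23 ho1
      ho3 hb3)

/-- The mirror: `a₃` with exactly the edges `{a₃, o}`, `{a₃, a₂}`, the chord along the other `o`-edge `{o, a₁}`. -/
theorem dChord_other_o_edge₂_of_o_root_star (hp : IsProbVec p) (hf : ends f = s(o, a₂))
    (hf' : ends f' = s(o, a₁)) (hg : ends g = s(a₃, o)) (he : ends e = s(a₃, a₂))
    (hstar : ∀ e', a₃ ∈ ends e' → e' = g ∨ e' = e) (h12 : a₁ ≠ a₂) (h13 : a₁ ≠ a₃) (h23 : a₂ ≠ a₃)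
    (ho1 : o ≠ a₁) (ho2 : o ≠ a₂) (ho3 : o ≠ a₃) (hb3 : b ≠ a₃) :
    NMixChord (normD ends a₁ a₂ a₃) p ends o a₁ a₂ a₃ b f' :=
  (nMixChord_normD_root_swap p ends b o a₁ a₂ a₃ f').1
    (dChord_other_o_edge_of_o_root_star p ends b hp hf hf' hg he hstar h12.symm h23 h13 ho2 ho1 ho3 hb3)

/-- The mirror of the `DZ2` row. -/
theorem dz2Chord_other_o_edge₂_of_o_root_star (hp : IsProbVec p) (hf : ends f = s(o, a₂))
    (hf' : ends f' = s(o, a₁)) (hg : ends g = s(a₃, o)) (he : ends e = s(a₃, a₂))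
    (hstar : ∀ e', a₃ ∈ ends e' → e' = g ∨ e' = e) (h12 : a₁ ≠ a₂) (h13 : a₁ ≠ a₃) (h23 : a₂ ≠ a₃)
    (ho1 : o ≠ a₁) (ho2 : o ≠ a₂) (ho3 : o ≠ a₃) (hb3 : b ≠ a₃) :
    NMixChord (normDZ2 ends a₁ a₂ a₃) p ends o a₁ a₂ a₃ b f' :=
  nMixChord_DZ2_of_D hp
    (dChord_other_o_edge₂_of_o_root_star p ends b hp hf hf' hg he hstar h12 h13 h23 ho1 ho2 ho3 hb3)
    (HCov_o_root_star₂ (Function.update p f' 0) ends b (hp.update f' le_rfl zero_le_one) hg he hstar h13 h23 ho2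
      ho3 hb3)

end BMain

end OStar

end Mix

end Summit.Ventures.PercRepro2
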